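import Summits.ValiantsHypothesis.ValiantsHypothesis.Theorems.LacunarySymmetroidMatrixDescartesCensusAtomM7K4QF70
import Summits.ValiantsHypothesis.ValiantsHypothesis.Theorems.LacunarySymmetroidMatrixDescartesCensusAtomM7K5EB104

/-!
# `MatrixDescartes` census — MIXED JUNCTION ROWS at `m = 7` from the atom blocks (block words, one line each)

HONEST FRAMING.  Experiment cell `val-V1-extremal`, width seat val-v1x-eng-8 g3 (`mixgen.py`).  Each theorem below is a census LOWER bound
`¬ PosRootLawAt 7 K (N − 1)` («some real symmetric `K`-letter `7 × 7` lacunary pencil has `N` distinct positive determinant roots»)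
obtained from kernel-certified ATOM BLOCKS of this cell (files `…CensusAtom*`: alternation certificate + Sylvester forms of the end letters,
all checked by the kernel) by the tree's JUNCTION LAW for matching junction inertia (`Chain.chain_append`, `…ChainInertia` /
`…ChainBlocks`, seat val-sym-mdr-p1) — alternation counts ADD, letter counts add minus one per junction — plus trailing grafts
(`+7` per added letter, `Reflect.not_posRootLawAt_of_certificateT_add`).  `ʳ` = block reversed (`x ↦ 1/x`, `Reflect.block_reverse`),
`⁻` = all letters negated (`blockNeg`).  No explicit chained pencil is ever written: the kernel checks each atom once and the words here
are bookkeeping.  Rows: (7,8) ≥ 174 [M7K5EB104 ▹ M7K4QF70] (was 147); (7,11) ≥ 244 [M7K5EB104 ▹ M7K4QF70 ▹ M7K4QF70] (was 222); (7,12) ≥ 278 [M7K5EB104 ▹ M7K5EB104ʳ ▹ M7K4QF70] (was 229); (7,13) ≥ 312 [M7K5EB104 ▹ M7K5EB104ʳ ▹ M7K5EB104] (was 252).  CONSTRUCTION-FAMILY provenance (junctions of flags/caps/towers found by the cell's engine seats —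
credits in the atom files).  Nothing here bears on the asymptotic crux `Theses.LacunarySymmetroid.MatrixDescartes`
(stmt-ValiantsHypothesis-18050) nor on `VP ≠ VNP`; VP ≠ VNP is NOT proved.  Generated 2026-08-29T03:13Z.  [folklore]
-/

-- `Summit.ValiantsHypothesis.ValiantsHypothesis.…` repeats a component by the D-0017 layout
-- (single-conjunct summit), which the `dupNamespace` linter flags; the name is mandated.
set_option linter.dupNamespace false

namespace Summit.ValiantsHypothesis.ValiantsHypothesis.Theorems.LacunarySymmetroidMatrixDescartes.Census.Reflect.MixM7

open Summit.ValiantsHypothesis.ValiantsHypothesis.Theorems.MatrixDescartes.Negative (PosRootLawAt)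
open Summit.ValiantsHypothesis.ValiantsHypothesis.Theorems.LacunarySymmetroidMatrixDescartes.Census
open Summit.ValiantsHypothesis.ValiantsHypothesis.Theorems.LacunarySymmetroidMatrixDescartes.Census.Reflect

/-- **`ζ_sym(7,8) ≥ 174`** (`¬ PosRootLawAt 7 8 173`) — the block word `M7K5EB104 ▹ M7K4QF70` = `104 + 70` alternations on
`5 + 4 − 1` letters (junction law for matching junction inertia; kernel value before this file: 147). ENDBOTH104 ▹ QUADFLAG70 (atoms by val-v1x-eng-2 g2 (quadric-seeded flags)). [folklore] -/
theorem mix_7_8 : ¬ PosRootLawAt 7 8 173 := by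
  have h := Chain.not_posRootLawAt_of_certificateT (by norm_num)
      (Chain.chain_append (by norm_num) (Chain.chain_of_block Reflect.AtomM7K5EB104.block)
        Reflect.AtomM7K4QF70.block (Equiv.refl (Fin 7)) (by intro i; fin_cases i <;> norm_num))
  norm_num at h
  exact h

/-- **`ζ_sym(7,11) ≥ 244`** (`¬ PosRootLawAt 7 11 243`) — the block word `M7K5EB104 ▹ M7K4QF70 ▹ M7K4QF70` = `104 + 70 + 70` alternations on
`5 + 4 + 4 − 2` letters (junction law for matching junction inertia; kernel value before this file: 222). [folklore] -/
theorem mix_7_11 : ¬ PosRootLawAt 7 11 243 := by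
  have h := Chain.not_posRootLawAt_of_certificateT (by norm_num)
      (Chain.chain_append (by norm_num) (Chain.chain_append (by norm_num) (Chain.chain_of_block Reflect.AtomM7K5EB104.block)
        Reflect.AtomM7K4QF70.block (Equiv.refl (Fin 7)) (by intro i; fin_cases i <;> norm_num))
        Reflect.AtomM7K4QF70.block (Equiv.refl (Fin 7)) (by intro i; fin_cases i <;> norm_num))
  norm_num at h
  exact h

/-- **`ζ_sym(7,12) ≥ 278`** (`¬ PosRootLawAt 7 12 277`) — the block word `M7K5EB104 ▹ M7K5EB104ʳ ▹ M7K4QF70` = `104 + 104 + 70` alternations on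
`5 + 5 + 4 − 2` letters (junction law for matching junction inertia; kernel value before this file: 229). [folklore] -/
theorem mix_7_12 : ¬ PosRootLawAt 7 12 277 := by
  have h := Chain.not_posRootLawAt_of_certificateT (by norm_num)
      (Chain.chain_append (by norm_num) (Chain.chain_append (by norm_num) (Chain.chain_of_block Reflect.AtomM7K5EB104.block)
        (block_reverse Reflect.AtomM7K5EB104.block) (Equiv.refl (Fin 7)) (by intro i; fin_cases i <;> norm_num))
        Reflect.AtomM7K4QF70.block (Equiv.refl (Fin 7)) (by intro i; fin_cases i <;> norm_num))
  norm_num at h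
  exact h

/-- **`ζ_sym(7,13) ≥ 312`** (`¬ PosRootLawAt 7 13 311`) — the block word `M7K5EB104 ▹ M7K5EB104ʳ ▹ M7K5EB104` = `104 + 104 + 104` alternations on
`5 + 5 + 5 − 2` letters (junction law for matching junction inertia; kernel value before this file: 252). [folklore] -/
theorem mix_7_13 : ¬ PosRootLawAt 7 13 311 := by
  have h := Chain.not_posRootLawAt_of_certificateT (by norm_num)
      (Chain.chain_append (by norm_num) (Chain.chain_append (by norm_num) (Chain.chain_of_block Reflect.AtomM7K5EB104.block)
        (block_reverse Reflect.AtomM7K5EB104.block) (Equiv.refl (Fin 7)) (by intro i; fin_cases i <;> norm_num))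
        Reflect.AtomM7K5EB104.block (Equiv.refl (Fin 7)) (by intro i; fin_cases i <;> norm_num))
  norm_num at h
  exact h

end Summit.ValiantsHypothesis.ValiantsHypothesis.Theorems.LacunarySymmetroidMatrixDescartes.Census.Reflect.MixM7
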